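import Summits.ResolutionOfSingularities.ResolutionOfSingularities.Theorems.TameQuotientLU2
import Literature.AlgebraicGeometry.Resolution.DecompositionLayerRegularity
import Literature.AlgebraicGeometry.Resolution.DecompositionLayerZMT
import Literature.AlgebraicGeometry.Resolution.DimensionFormula
import Literature.AlgebraicGeometry.Resolution.NormalLocalZMT
import Literature.AlgebraicGeometry.Resolution.NormalModels
import Literature.AlgebraicGeometry.Resolution.SmoothUniformization
import Literature.AlgebraicGeometry.Resolution.ExcellentRingsFieldProofs
import HarnessLib

/-!
# DecompositionDescentLU — local uniformization COMES DOWN through the decomposition layer of the henselization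
(decomp-res node «DecompositionDescent», lens-1 «grading / quantitative ladder», g27)

Critic window (CRITIC-LEDGER rows 178 (K-e′)=(L1), 193 (W-dec), 202 (W-dec) IN WITNESS CURRENCY): *the kernel
law of decomposition descent `K ⊆ K₁ ⊆ K^h`, hypothesis-free or with at most three typed standard facts
(finiteness of normalization; ZMT local form; local-étale descent of regularity); row 202: the cell as
standard-étale WITNESSES over the model (monic, unit derivative) with the model-with-witnesses regular
upstairs, law `F1 → F3 → cell → RelLU` with Mathlib/tree inventory first; the exact re-location, the root by
name, one paper instance.*  DELIVERED: BOTH currencies, and NO fact binder survives the inventory — F1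
(normalization finite) is the tree's `exists_adjoin_isIntegrallyClosedIn`, F3 (étale descent of regularity
through the decomposition layer) is the tree's `DecompositionLayerRegularity` (44)(45) completed here, F2′ and
ZMT are not needed for the witness law (ZMT serves only layer 2, PART D).

## What this file PROVES (0 `sorry`, no new axiom, no port, no `TheoremD`, no named fact as hypothesis of a law)

Reading of [CossartPiltant2008, Prop. 9.3] (HAL pp. 26–28), the ONLY place in print where local
uniformization is brought down from the henselization, shows that its proof has THREE layers, of which
exactly ONE is of summit strength:

* **Layer 1 — étale descent of regularity through a decomposition layer** ((44)(45): `K′ ⊆ K^h = K̄^{G_Z}`,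
  Galois approximation `R₁/𝔪₁ⁿ = R₁′/𝔪₁′ⁿ`, `R̂₁ = R̂₁′`, so `R₁` is regular iff `R₁′` is).  KERNEL HERE:
  `relLU_of_decompositionFieldLUAbove : DecompositionFieldLUAbove k O → RelLocalUniformization k K O`
  (PART B; engine `exists_finset_regular_below`, PART A, over the tree's `DecompositionLayerRegularity`,
  made hypothesis-free: the inclusion `K(η) ⊆ Z` is PROVED from the rigidity of Hensel roots
  (`closure_le_decompositionField`, via g23 `GaloisDescentLU.apply_eq_of_henselRoot`) and the dimension
  equality `dim R₁ = dim R₁′` is PROVED by the dimension formula (`ringKrullDim_centre_eq_of_isIntegral`)).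
* **Layer 2 — "by (52) and Zariski's Main Theorem, `R` lies below `S′`"**: an upstairs regular model whose
  closed point is radically cut out by finitely many `K`-rational functions IS the local ring of the
  normalized base change of a normal model downstairs.  KERNEL HERE:
  `decompositionFieldLUAbove_of_quasiFiniteLUAbove : QuasiFiniteLUAbove k O → DecompositionFieldLUAbove k O`
  (PART D; engine `exists_normalization_regular_of_quasiFinite` over the tree's `NormalModels`
  (finiteness of normalization), `exists_adjoin_eq_integralClosure_extension` and
  `locAtCentre_le_locAtCentre_of_forall_isPrime` (ZMT, birational local form)); composite
  `relLU_of_quasiFiniteLUAbove : QuasiFiniteLUAbove k O → RelLocalUniformization k K O`.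
* **Layer 3 — producing the quasi-finite input from a uniformization of `(K′, O′)`**: [CossartPiltant2008,
  Prop. 8.1 + (46)–(51)]: MONOMIALIZATION of the conjugates `g′₁, σ₂g′₁, …` and of the `H_j` in a regular
  system of parameters AFTER FURTHER BLOWING UP UPSTAIRS — i.e. embedded principalization on a regular
  model of dimension `n` (their Prop. 4.1, proved in dimension 3 from CJS-embedded resolution of surfaces;
  OPEN in dimension `≥ 4`, Hironaka-strength).  NOT CLAIMED HERE: it is the honest residual crux of the
  critic's literal (L1) and is typed for g28 (NEXT-g28.md, `MonomialBlowupAbove`).  So the literal (L1)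
  `RelLU k K₁ O₁ → RelLU k K O` is NOT a "≤ three standard facts" law: its third fact is principalization.
  All three STANDARD facts the critic allowed as binders (normalization finite; ZMT; étale descent of
  `IsRegularLocalRing`) are DISCHARGED IN THE KERNEL here — none is a binder.

* **Layer 1 in WITNESS currency (row 202's cell; PART E)**: `DecWitnessLUAbove k O` — a finite separable top
  `K′`, and for every model `R ⊆ O` finitely many witnesses `x′ ⊆ K′ ∩ O_E` STANDARD-ÉTALE OVER THE MODEL
  `R[t]` (monic `g ∈ R[t][X]`, `v(g′(x′)) = 0`) with `K`-RATIONAL RESIDUES (`⟺ x′ ∈ K^h`, since `κ(K^h) = κ(K)`;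
  witnesses without it are the INERT kind `K^h ⊊ K^{sh}`, NEXT-g28) and `R[t][x′]` regular at the centre.
  KERNEL HERE, HYPOTHESIS-FREE: `relLU_of_decWitnessLUAbove : DecWitnessLUAbove k O → RelLocalUniformization k K O`
  (engine `exists_finset_regular_below_of_witnesses`: the Galois-approximation coefficients are fixed from
  the Galois closure of `K′` BEFORE the model is chosen; NORMALIZATION SANDWICH
  `exists_normalization_regular_of_witnesses`: the regular — hence normal — local ring of `R[c][t][x′]` IS
  the local ring of the integral closure `k[t₁ ∪ t₁′]` of the normal model `k[t₁] ⊇ R[c][t]` in `K(x′) ⊆ Z`,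
  so the layer-1 engine applies).  The verbatim residue-free draft `UnramifiedWitnessLUAbove k O` is typed,
  with `decWitness_le_unramifiedWitness`; and, said openly (row 202 probe), `decWitnessLUAbove_of_relLU :
  RelLU → DecWitnessLUAbove` (`K′ = K`, `x′ = ∅`): the witness cell is an EXACT coordinate of `RelLU`
  (`DecWitnessLUAbove k O ↔ RelLocalUniformization k K O`), whose content is the law for genuine tops.

Decided / undecided pieces (root = `ResolutionOfSingularities`):
* `DecompositionFieldLUAbove k O` (PART B) — the CELL of layer 1 in structure currency (a Hensel layer
  `K ≤ K′ ≤ K(η) ⊆ K^h` in which the normalized base changes of the normal models of `K` uniformize);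
  `DecWitnessLUAbove k O` (PART E) — the same layer in WITNESS currency (row 202); `QuasiFiniteLUAbove k O`
  (PART D) — the CELL of layer 2 (quasi-finite uniformization upstairs, (52)-form); kernel laws
  `QuasiFiniteLUAbove → DecompositionFieldLUAbove → RelLU` and `DecWitnessLUAbove → RelLU`.
* `NonKHToricArchLUKeyHenselDescentQuotDecCell e c n`, `…DecWCell e c n`, `…QFCell e c n` — DECIDED (`…_holds`),
  WEAKER than the root: the g25 located residual ON the structure cell / the witness cell / the quasi-finite cell.
* `NonKHToricArchLUKeyHenselDescentQuotDec e c n` =: **R27** — UNDECIDED, WEAKER than the root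
  (`…QuotDec_of_root`): the located residual OFF the key-chain, Hensel, descent, tame-quotient AND BOTH
  decomposition-descent cells (hence off the quasi-finite cell, `not_quasiFiniteLUAbove_of_not_…`); its
  docstring names the UNMATCHED residue clauses (g25/g26: residues in `k`; here: `κ(O) | k` algebraic,
  witnesses with `K`-rational residues; inert layer not consumed).
* EXACT hypothesis-free re-location `R25 ↔ R27`: `nonKHToricArchLUKeyHenselDescentQuot_iff_dec` (all
  `(e,c,n)`), `…Quot334_iff_dec`; one-step forms `R23 ↔ R27` (`nonKHToricArchLUKeyHenselDescent_iff_dec`) and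
  `NonKHToricArchLU ↔ R27` (`nonKHToricArchLU_iff_dec`, the g17/g20 true residual family).
* ROOT BY NAME: `closes_dec : CossartPiltant2019LU3 → CossartJannsenSaito2020Embedded → KK05NCVAscent →
  (∀ d ≥ 4, R27 3 3 d) → Valuative.PatchingRel → ResolutionOfSingularities`, and the Σ-equivalence
  `root_iff_dec_sigma`.  (g26's `R26`/`closes_abel` is not yet landed; the same `by_cases` gives
  `R26 ↔ R26 ∧ ¬Dec` verbatim once it is — NODE-g27.md §6.)

Tags.  COSTUME: none among the residual pieces; the witness cell is OPENLY `RelLU`-equivalent (C27-8) — it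
is a coordinate, and the paying object is the LAW for `K(x′) ≠ K`, not the cell; `RelLU →
DecompositionFieldLUAbove` would need étale ASCENT plus realising an arbitrary regular model upstairs as the
normalization of a normal model downstairs, and `RelLU → QuasiFiniteLUAbove` needs in addition the radical
`K`-rational cut-out (52), which is exactly what Prop. 8.1 manufactures (probes R7, R8 fail as they should);
WEAKER: every residual is implied by the root (`…_of_root`); UNDECIDED: R27.
Leaves: R27 — ATTACKABLE (next cells: `MonomialBlowupAbove` = layer 3 typed as a B-currency cell in
dimension 3 where [CossartPiltant2008, Prop. 4.1] holds, IDEA-NEEDED in dimension `≥ 4`); the layer-3 law —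
BARRIER-adjacent (embedded principalization in dimension `n` in characteristic `p`).

## Why novel (relative to g17–g26 and the tree)

g23 descended ONE `K^h`-chart whose equations are over `K` and FIXED by the Galois action (split descent,
`GaloisHenselDescentDatum`); g25/g26 descended TAME / ABELIAN QUOTIENT charts through INERTIA (`p ∤ |G_T|`).
This node descends through the DECOMPOSITION group — the part of `Gal(K^sep | K)` that inertia methods do
not see and where NO group-order hypothesis is available: the lever is not invariants but COMPLETION
(`R̂₁ = R̂₁′` by Galois approximation in `G_Z`) + NORMALIZATION + ZMT.  The tree's Literature files
`DecompositionLayer{Density,Regularity,ZMT}` typed the three standard facts for the Cossart–Piltant port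
(`hDec` is a HYPOTHESIS of `cossartPiltant2019ReductionP_of_cjs_of_stableInertiaHensel`); here they are
assembled, for the first time, into hypothesis-free SUMMIT-FRAME laws over an arbitrary ground field `k` and
arbitrary transcendence degree, with the two inputs the port left open (`K′ ⊆ Z`, `dim R₁ = dim R₁′`)
proved, and cut into the residual programme (`R25 ↔ R27`, root by name).  The WITNESS law (PART E) is the
first kernel statement in this cell in which the top is described by EQUATIONS OVER THE MODEL (standard-étale
witnesses, [EGA IV₄, 18.4.6]-shape) rather than by a Galois-theoretic position, and its proof needs one idea
not in print at this place: regular ⇒ normal lets the NORMALIZATION of the model-with-witnesses be computed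
as an integral closure of a normal model downstairs, so that étale descent applies WITHOUT Zariski's Main
Theorem and WITHOUT flatness of the witnesses over the (possibly non-normal) model.

## Why each piece is strictly weaker than the root

The cell pieces are decided (kernel theorems), hence weaker.  R27 is implied by the root (`…_of_root`) and
is the root's located residual with one more negated syntactic hypothesis; the converse `R27 → root` needs
the floor, CJS, Π₁ and the patching crux 0642 (`closes_dec`), none of which R27 asserts — the probe
`R27 → ResolutionOfSingularities` by `exact?`/`aesop` FAILS (bc/Probe.lean).

Sources: [CossartPiltant2008] V. Cossart, O. Piltant, J. Algebra 320 (2008) 1051–1082 = HAL hal-00139124,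
Prop. 8.1, Problem 9.2, Prop. 9.3 with (44)–(52) (pp. 22, 26–28); [Kuhlmann2000] F.-V. Kuhlmann, Valuation
theoretic and model theoretic aspects of local uniformization, §13 (henselization descent problem);
[KnafKuhlmann2005]/[KnafKuhlmann2009] (LU in the henselization / by alterations); [Abhyankar1959] Ramification
theoretic methods, Thm. 1.47 (Galois approximation in the decomposition group); [StacksProject, 00Q9] (ZMT);
[EGAIV2, 7.8.3] (excellence: analytic normality, finiteness of normalization).
-/

noncomputable section

open IsLocalRing IntermediateField Polynomial Literature.AlgebraicGeometry.Resolution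
open scoped Pointwise

namespace Summit.ResolutionOfSingularities.ResolutionOfSingularities.Theorems.DecompositionDescentLU

universe u

/-! ## PART A — the engine in the frame of a big field `E` (`M ⊆ K′ ⊆ E`, a valuation ring `O_E` of `E`) -/

section Engine

variable {E : Type u} [Field E] (OE : ValuationSubring E) {M : Subfield E}

/-! ### A1. Hensel roots: algebraicity, separability, rigidity under the decomposition group -/

/-- A polynomial of `E[X]` with coefficients in the subfield `M` is the image of a polynomial of `M[X]`.
[folklore] -/
theorem exists_map_eq_of_coeff_mem {f : E[X]} (hfM : ∀ i, f.coeff i ∈ M) :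
    ∃ f₀ : Polynomial M, f₀.map (algebraMap M E) = f := by
  have hl : f ∈ Polynomial.lifts (algebraMap M E) := by
    rw [Polynomial.lifts_iff_coeff_lifts]
    intro i
    exact ⟨⟨f.coeff i, hfM i⟩, rfl⟩
  exact (Polynomial.mem_lifts _).mp hl

/-- A root `η` of a polynomial `f` over `M ∩ O_E` with `f′(η)` a unit of `O_E` (a HENSEL ROOT) is integral over
`M` (the polynomial is nonzero since `v(f′(η)) = 1`). [folklore] -/
theorem isIntegral_of_henselRoot {η : E} {f : E[X]} (hfM : ∀ i, f.coeff i ∈ M) (hfη : f.eval η = 0)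
    (hder : OE.valuation ((derivative f).eval η) = 1) : IsIntegral M η := by
  obtain ⟨f₀, hf₀⟩ := exists_map_eq_of_coeff_mem hfM
  have hf0 : f ≠ 0 := by
    rintro rfl
    rw [derivative_zero, eval_zero, map_zero] at hder
    exact zero_ne_one hder
  have hf₀0 : f₀ ≠ 0 := by
    rintro rfl
    rw [Polynomial.map_zero] at hf₀
    exact hf0 hf₀.symm
  have haev : aeval η f₀ = 0 := by
    rw [aeval_def, ← eval_map, hf₀, hfη]
  exact (show IsAlgebraic M η from ⟨f₀, hf₀0, haev⟩).isIntegral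

/-- A Hensel root is SEPARABLE over `M`: its minimal polynomial divides `f` and has `η` as a simple root, hence
has nonzero derivative. [folklore] -/
theorem isSeparable_of_henselRoot {η : E} {f : E[X]} (hfM : ∀ i, f.coeff i ∈ M) (hfη : f.eval η = 0)
    (hder : OE.valuation ((derivative f).eval η) = 1) : IsSeparable M η := by
  obtain ⟨f₀, hf₀⟩ := exists_map_eq_of_coeff_mem hfM
  have hint : IsIntegral M η := isIntegral_of_henselRoot OE hfM hfη hder
  have haev : aeval η f₀ = 0 := by
    rw [aeval_def, ← eval_map, hf₀, hfη]
  obtain ⟨q, hq⟩ := minpoly.dvd M η haev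
  have hder' : aeval η (derivative (minpoly M η)) ≠ 0 := by
    intro h0
    have h1 : aeval η (derivative f₀) = 0 := by
      rw [hq, derivative_mul, map_add, map_mul, map_mul, minpoly.aeval, h0, zero_mul, zero_mul,
        add_zero]
    have h2 : (derivative f).eval η = 0 := by
      rw [← hf₀, derivative_map, eval_map, ← aeval_def, h1]
    rw [h2, map_zero] at hder
    exact zero_ne_one hder
  have hd0 : derivative (minpoly M η) ≠ 0 := by
    intro h0
    exact hder' (by rw [h0, map_zero])
  exact (separable_iff_derivative_ne_zero (minpoly.irreducible hint)).mpr hd0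

/-- Elements of the decomposition group `G_Z(O_E ∩ N | M)` preserve "`v < 1`" on `N`. [folklore] -/
theorem valuation_lt_one_of_mem_decompositionGroupIn (N : IntermediateField M E) {σ : N ≃ₐ[M] N}
    (hσ : σ ∈ decompositionGroupIn OE N) {y : N} (hy : OE.valuation (y : E) < 1) :
    OE.valuation ((σ y : N) : E) < 1 := by
  have hst : ∀ x : N, (x : E) ∈ OE ↔ ((σ x : N) : E) ∈ OE := (mem_decompositionGroupIn_iff OE N σ).mp hσ
  by_cases hy0 : y = 0
  · simp [hy0]
  rw [← not_le] at hy ⊢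
  intro hle
  apply hy
  have hσy0 : ((σ y : N) : E) ≠ 0 := by
    intro h
    apply hy0
    have : σ y = 0 := Subtype.ext h
    simpa using this
  have h1 : ((σ y : N) : E)⁻¹ ∈ OE := by
    rw [← OE.valuation_le_one_iff, map_inv₀]
    exact (inv_le_one₀ (zero_lt_one.trans_le hle)).mpr hle
  have h2 : ((y⁻¹ : N) : E) ∈ OE := by
    rw [hst, map_inv₀]
    push_cast
    exact h1
  have h3 := (OE.valuation_le_one_iff _).mpr h2
  push_cast at h3
  have hy0' : (y : E) ≠ 0 := fun h => hy0 (Subtype.ext h)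
  rwa [map_inv₀, inv_le_one₀ ((Valuation.pos_iff _).mpr hy0')] at h3

/-- **The field generated by `M` and a Hensel root `η` with `M`-rational residue lies in the decomposition
field.**  For a Galois `N | M` inside `E` containing `η`: every `σ ∈ G_Z(O_E ∩ N | M)` fixes `η` (rigidity of
Hensel roots, tree `GaloisDescentLU.apply_eq_of_henselRoot`), so `M(η) ⊆ Z = N^{G_Z}`. (Sources: KnafKuhlmann2009,
Lemma 3.7.) -/
theorem closure_le_decompositionField (N : IntermediateField M E) {η : E} (hηN : η ∈ N) (hηO : η ∈ OE)
    {x₀ : E} (hx₀ : x₀ ∈ M) (hηx₀ : OE.valuation (η - x₀) < 1) {f : E[X]} (hfM : ∀ i, f.coeff i ∈ M)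
    (hfO : ∀ i, f.coeff i ∈ OE) (hfη : f.eval η = 0) (hder : OE.valuation ((derivative f).eval η) = 1) :
    Subfield.closure ((M : Set E) ∪ {η}) ≤
      (IntermediateField.lift (fixedField (decompositionGroupIn OE N))).toSubfield := by
  classical
  obtain ⟨f₀, hf₀⟩ := exists_map_eq_of_coeff_mem hfM
  set Z : IntermediateField M E := IntermediateField.lift (fixedField (decompositionGroupIn OE N)) with hZ
  have hMZ : (M : Set E) ⊆ (Z.toSubfield : Set E) := fun x hx => by
    have : algebraMap M E ⟨x, hx⟩ ∈ Z := Z.algebraMap_mem _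
    exact this
  -- `η` read in `N`, the polynomial `f` read in `N[X]`
  let ηN : N := ⟨η, hηN⟩
  set fN : Polynomial N := f₀.map (algebraMap M N) with hfN
  have hfNE : fN.map (algebraMap N E) = f := by
    rw [hfN, Polynomial.map_map, ← IsScalarTower.algebraMap_eq, hf₀]
  have hηZ : η ∈ Z := by
    have h1 : ηN ∈ fixedField (decompositionGroupIn OE N) := by
      rw [IntermediateField.mem_fixedField_iff]
      intro σ hσ
      have hcoefV : ∀ i, ((fN.coeff i : N) : E) ∈ OE := fun i => by
        have : ((fN.coeff i : N) : E) = f.coeff i := by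
          rw [← hfNE]; simp only [hfN, Polynomial.coeff_map]; rfl
        rw [this]; exact hfO i
      have hcoefg : ∀ i, σ (fN.coeff i) = fN.coeff i := fun i => by
        simp only [hfN, Polynomial.coeff_map]
        exact σ.commutes _
      have hfηN : fN.eval ηN = 0 := by
        apply (algebraMap N E).injective
        rw [← Polynomial.eval₂_hom, ← Polynomial.eval_map, hfNE, map_zero]
        exact hfη
      have hderN : OE.valuation (((derivative fN).eval ηN : N) : E) = 1 := by
        have : (((derivative fN).eval ηN : N) : E) = (derivative f).eval η := by
          change algebraMap N E ((derivative fN).eval ηN) = _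
          rw [← Polynomial.eval₂_hom, ← Polynomial.eval_map, ← Polynomial.derivative_map, hfNE]
          rfl
        rw [this]; exact hder
      have hresN : OE.valuation (((σ ηN : N) : E) - ηN) < 1 := by
        let xN : N := algebraMap M N ⟨x₀, hx₀⟩
        have hσx : σ xN = xN := σ.commutes _
        have hd : OE.valuation (((ηN - xN : N) : E)) < 1 := by
          push_cast
          exact hηx₀
        have hσd := valuation_lt_one_of_mem_decompositionGroupIn OE N hσ hd
        have heq : ((σ ηN : N) : E) - ηN = ((σ (ηN - xN) : N) : E) - ((ηN - xN : N) : E) := by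
          rw [map_sub, hσx]
          push_cast
          ring
        rw [heq]
        exact lt_of_le_of_lt (Valuation.map_sub _ _ _) (max_lt hσd hd)
      exact GaloisDescentLU.apply_eq_of_henselRoot OE N hσ hηO fN hcoefV hcoefg hfηN hderN hresN
    exact (IntermediateField.mem_lift ηN).mpr h1
  refine Subfield.closure_le.mpr ?_
  rintro x (hx | hx)
  · exact hMZ hx
  · rw [Set.mem_singleton_iff] at hx
    rw [hx]
    exact hηZ

/-! ### A2. Integral extensions of affine models keep the dimension of the local ring at the centre -/

set_option maxHeartbeats 1600000 in
/-- **`dim (k[t₁])_𝔪 = dim (k[t₁ ∪ t₁′])_𝔪′` for an integral extension of affine models** (`k[t₁ ∪ t₁′]`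
integral over `k[t₁]`, both read at the centre of `O_E`): the dimension formula for the universally catenary
affine domain `k[t₁]` (Matsumura Thm. 15.6, tree `height_eq_height_of_liesOver_of_isUniversallyCatenaryRing`;
residue extension algebraic because the ring extension is integral). (Sources: Matsumura1987, Thm. 15.6.) -/
theorem ringKrullDim_centre_eq_of_isIntegral (k : Type u) [Field k] [Algebra k E] (t₁ t₁' : Finset E)
    (ht₁O : (Algebra.adjoin k (t₁ : Set E)).toSubring ≤ OE.toSubring)
    (hO' : (Algebra.adjoin k ((t₁ : Set E) ∪ (t₁' : Set E))).toSubring ≤ OE.toSubring)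
    (hint : ∀ x ∈ Algebra.adjoin k ((t₁ : Set E) ∪ (t₁' : Set E)),
      IsIntegral (Algebra.adjoin k (t₁ : Set E)) x) :
    ringKrullDim (Localization.AtPrime (Ideal.comap (Subring.inclusion ht₁O) (maximalIdeal OE))) =
      ringKrullDim (locAtCentre (Algebra.adjoin k ((t₁ : Set E) ∪ (t₁' : Set E))).toSubring OE) := by
  classical
  set T : Subalgebra k E := Algebra.adjoin k (t₁ : Set E) with hTdef
  set T' : Subalgebra k E := Algebra.adjoin k ((t₁ : Set E) ∪ (t₁' : Set E)) with hT'def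
  have hTT' : T ≤ T' := Algebra.adjoin_mono Set.subset_union_left
  haveI : Algebra.FiniteType k T := (Subalgebra.fg_iff_finiteType _).mp (Subalgebra.fg_adjoin_finset _)
  haveI : Algebra.FiniteType k T' := by
    rw [hT'def, ← Finset.coe_union]
    exact (Subalgebra.fg_iff_finiteType _).mp (Subalgebra.fg_adjoin_finset _)
  letI : Algebra T T' := (Subalgebra.inclusion hTT').toRingHom.toAlgebra
  have halg : ∀ x : T, ((algebraMap T T' x : T') : E) = x := fun _ => rfl
  haveI : IsScalarTower k T T' := IsScalarTower.of_algebraMap_eq fun c => Subtype.ext rfl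
  haveI : IsScalarTower T T' E := IsScalarTower.of_algebraMap_eq fun x => rfl
  haveI : Algebra.FiniteType T T' := Algebra.FiniteType.of_restrictScalars_finiteType k T T'
  haveI : FaithfulSMul T T' :=
    (faithfulSMul_iff_algebraMap_injective T T').mpr (Subalgebra.inclusion_injective hTT')
  haveI : Algebra.IsIntegral T T' := ⟨fun y =>
    (isIntegral_algHom_iff (IsScalarTower.toAlgHom T T' E) Subtype.val_injective).mp (hint y y.2)⟩
  haveI : Algebra.IsAlgebraic T T' := Algebra.IsIntegral.isAlgebraic
  -- the two centres
  let p : Ideal T := Ideal.comap (Subring.inclusion ht₁O) (maximalIdeal OE)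
  let P : Ideal T' := Ideal.comap (Subring.inclusion hO') (maximalIdeal OE)
  haveI hpp : p.IsPrime := Ideal.IsPrime.comap _
  haveI hPp : P.IsPrime := Ideal.IsPrime.comap _
  have hp : ∀ z : T, z ∈ p ↔ OE.valuation (z : E) < 1 := fun z => by
    change Subring.inclusion ht₁O z ∈ maximalIdeal OE ↔ _
    rw [ValuationSubring.valuation_lt_one_iff]
    rfl
  have hP : ∀ z : T', z ∈ P ↔ OE.valuation (z : E) < 1 := fun z => by
    change Subring.inclusion hO' z ∈ maximalIdeal OE ↔ _
    rw [ValuationSubring.valuation_lt_one_iff]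
    rfl
  haveI : P.LiesOver p := ⟨Ideal.ext fun z => by
    rw [hp]
    change _ ↔ algebraMap T T' z ∈ P
    rw [hP]
    rfl⟩
  haveI : IsDomain (T ⧸ p) := Ideal.Quotient.isDomain p
  haveI : Algebra.IsIntegral (T ⧸ p) (T' ⧸ P) := Ideal.Quotient.algebra_isIntegral_of_liesOver P p
  haveI : Algebra.IsAlgebraic (T ⧸ p) (T' ⧸ P) := Algebra.IsIntegral.isAlgebraic
  have hh : P.height = p.height :=
    height_eq_height_of_liesOver_of_isUniversallyCatenaryRing
      (isUniversallyCatenaryRing_of_finiteType_field k T) p P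
  -- both local rings are the localisations at the centres
  let e' : Localization.AtPrime P ≃+* locAtCentre T'.toSubring OE := (locAtCentreEquiv hO').toRingEquiv
  rw [← ringKrullDim_eq_of_ringEquiv e', IsLocalization.AtPrime.ringKrullDim_eq_height p,
    IsLocalization.AtPrime.ringKrullDim_eq_height P, hh]

end Engine

end Summit.ResolutionOfSingularities.ResolutionOfSingularities.Theorems.DecompositionDescentLU

end
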